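import Literature.AnabelianGeometry.EtaleTheta.ThetaKummerInversionFixedPoints
import Literature.AnabelianGeometry.EtaleTheta.ThetaKummerInputDeckOfCore
import Literature.AnabelianGeometry.EtaleTheta.SettingModelChiInversionSectionTau
import Literature.AnabelianGeometry.EtaleTheta.ThetaKummerInversionBTwistNoGo
import Literature.AnabelianGeometry.EtaleTheta.ThetaKummerInversionBTwistNoGoTate
import Literature.AnabelianGeometry.EtaleTheta.SettingModelTateDeckLevels
import Literature.AnabelianGeometry.EtaleTheta.SettingModelTateZClass
import Literature.AnabelianGeometry.EtaleTheta.SettingModelTateYTheta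
import Literature.AnabelianGeometry.EtaleTheta.SettingModelGfpRigidity
import HarnessLib

/-!
# NO `Δ^tp_Y`-INNER LIFT of the inversion carries the FUNCTION-level [EtTh] Prop 1.4 (ii) package at the
# χ-twisted root model — transport of packages along `Δ^tp_Ÿ`-conjugation, and the half-twisted fixed sections
# (proof-only)

S. Mochizuki, *The étale theta function …*, Publ. RIMS **45** (2009) [EtTh]: Prop 1.4 (ii) p. 22
(«`Θ̈(Ü⁻¹) = −Θ̈(Ü)`»), Prop 1.3 p. 21 (Kummer classes of constants), §2 p. 36 (the inversion `ι`);
*Inter-universal Teichmüller theory II*, Rmk 1.4.1 (ii) p. 28: the inversion `ι_Ÿ` is «uniquely determined up to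
`l·Z`-conjugacy and composition with an element `∈ Gal(Ÿ_k/Y_k)`», i.e. a `Δ^tp_Ÿ`-OUTER automorphism — its lifts to
`Aut(Π^tp)` fixing the vertex `0` are the `Ad(γ) ∘ ι`, `γ ∈ Δ^tp_Y`. Classical here. [cite: MochizukiEtTh2009, Prop 1.4 (ii) p.22]

abc-iut cell, layer L2, seat abc-iut-w5-d125 (gen 8); PROOF-ONLY (NO definition, NO `Prop` fact, NO instance; D-0067).
Sequel of this seat's `ThetaKummerInversionFixedPoints.lean` (p447891/p448600/p455375: the no-go for the inversion OF
RECORD at `modelχ`, finding F-w5d125g7-1) and of abc-iut-w5-d140's `ThetaKummerInversionBTwistNoGo.lean` (p452126: the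
`b`-AXIS lifts `Ad(b^s) ∘ ι` at `modelχ` — even `s` for all `p`, odd `s` for `p ≡ 1 (mod 4)` via the 4-torsion section of
`τ = √−1`; census «surviving candidates are lifts OFF the `b`-axis») / `…NoGoTate.lean` (p454176, stage 2). Consumed BY
NAME: `KummerCore.not_exists_package_of_constCompat_of_fixed`, `invχ`, `exists_continuousMulEquiv_bTwist_invχ`,
`not_exists_package_modelχq_bTwist_of_constCompat`, abc-iut-L2-t6's `sectionχ` / `sectionχ_mem_YNχ_iff`, abc-iut-w5-d118's
`twistedInversion_sectionχ` / `conj_inl_bPowGfp_sectionχ`, abc-iut-w5-d171's `half`. CONE-L2-STATUS v3.5/v3.7 left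
open «instantiation needs a DIFFERENT LIFT». THIS FILE closes that loophole for the WHOLE `Δ^tp_Y`-inner class:

* §1 `ThetaKummerInput.exists_package_conj_of_exists_package` (GENERIC, any theta setting): the function-level package
  `{ιFn, hιFn, hΛ, hιθ}` TRANSPORTS along conjugation by any `w ∈ Δ^tp_Ÿ` (`w ∈ Π^tp_Ÿ`, `aug w = 1`): if `ι' = Ad(w) ∘ ι`
  pointwise then `ιFn' := w • ιFn(·)` is a package for `ι'` (`w` fixes `Θ̈` and the constants, and acts trivially on
  `Λ(Fn) ≅ Δ_Θ` because `Δ^Θ` centralises `Δ_Θ` — needs `Λ(Fn) → Δ_Θ` injective). So non-vacuity / vacuity of the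
  package is an invariant of the `Δ^tp_Ÿ`-conjugacy class of the lift — and every OFF-axis lift `Ad(inl γ) ∘ ι`,
  `inl γ ∈ Π^tp_Y`, is `Δ^tp_Ÿ`-conjugate to the `b`-axis lift `Ad(inl b^{ŷ(γ)}) ∘ ι`.
* §2 `SettingModel.not_exists_package_modelχ_bAxisLift_of_constCompat` — the `b`-axis no-go for EVERY `z ∈ Ẑ` AND EVERY
  `p` (removing the `p ≡ 1 (mod 4)` restriction of p452126's odd case): for every `ι'` agreeing pointwise with
  `Ad(inl b^z) ∘ ι`, NO package with genuine constants (`ConstCompat kummerDataχ`). New fixed family (no rational `√−1`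
  needed): the `b`-axis sections TWISTED BY HALF THE `χ`-COBOUNDARY OF `z`, `s(σ) = ⟨b^{f σ}, σ⟩` with `(f σ)² = z/χ(σ)z`
  (`half`), are `Ad(b^z) ∘ ι`-FIXED for every `σ` (`ι` inverts the twist, `Ad(b^z)` multiplies it by `z/χ(σ)z`), and lie
  in `Π^tp_Ÿ` exactly when `f σ` is even, which holds on the OPEN subgroup `G_{K_4}` (`χ ≡ 1 (mod 4)` there): an
  `ι'`-fixed subgroup of `Π^tp_Ÿ` with Galois image `G_{K_4}`, `K_4 = ℚ_p(ζ₄, √q_X)` finite.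
* §3 `SettingModel.not_exists_package_modelχ_innerLift_of_constCompat` — **for EVERY `γ ∈ Γ` of degree `0`
  (`inl γ ∈ Π^tp_Y`, i.e. every vertex-`0` lift `Ad(inl γ) ∘ ι`, on OR off the `b`-axis) and every `T` with injective
  `Λ(Fn) → Δ_Θ` and `ConstCompat kummerDataχ`: NO package** (`w := inl(b^{ŷ(γ)}·γ⁻¹) ∈ Δ^tp_Ÿ`; §1 + §2).
* §4 `SettingModel.not_exists_package_modelχq_innerLift_of_constCompat` — the same at the Prop 1.5 (iii)-carrying Tate
  instance `modelχq p 1 2` (`p ≡ 1 (mod 4)`), from §1 and abc-iut-w5-d140's stage-2 `b`-axis theorem.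

MODEL-DESIGN CONSEQUENCE (numbers, not a side; SHAPES memo v2): since print's `ι_Ÿ` is a `Δ^tp_Ÿ`-OUTER automorphism
composed with `Gal(Ÿ/Y)` ([IUTchII] Rmk 1.4.1 (ii)), §3 exhausts the vertex-`0` lifts of the inversion of record: at
`modelχ` the L6 consumers' function-level binders (`hιFn ∧ hΛ ∧ hιθ` with genuine constants) are NOT instantiable for ANY of
them — not a matter of choosing the lift. Diagnosis: in `Γ ⋊_χ G_{ℚ_p}` with `Γ` free and the complement `inr G`
untwisted, every `b`-direction twist of a Galois section admits half-twisted FIXED sections over an open subgroup; in print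
the inversion fixes only CUSPIDAL decomposition groups, on which it acts through the inertia (commutator-direction) Kummer
character of `−1` — a CENTRAL twist, which no automorphism over `G` of a free-`Γ` semidirect model carries (the twisting
cocycle would have to centralise `Γ`). A positive NV witness therefore needs a model whose Galois sections at the cusps are
inertia-twisted (recorded for the R78 successors; no such model is in the tree).

HONEST FRAMING: classical group theory over the cell's typed interface and its SEMI-SYNTHETIC χ-model (consistency
evidence only); nothing disputed is asserted; no side is taken on [IUTchIII] Cor 3.12; typed ≠ proved.
-/

noncomputable section

namespace Literature.AnabelianGeometry.EtaleTheta

open Literature.AnabelianGeometry.SemiGraphs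

/-! ### §1. Transport of the function-level package along `Δ^tp_Ÿ`-conjugation (generic) -/

namespace ThetaSetting

namespace ThetaKummerInput

variable {p : ℕ} [Fact p.Prime] {D : ThetaSetting p} (T : D.ThetaKummerInput)

/-- An element of `Δ^tp_X` (trivial augmentation) acts trivially on the cyclotome `Λ(Fn)`, provided `Λ(Fn) → Δ_Θ` is
injective: `Δ^Θ` centralises `Δ_Θ` and the coefficients are equivariant. [cite: MochizukiEtTh2009, §1 p.12] -/
theorem smul_cyclotome_eq_self_of_aug_eq_one (hinj : Function.Injective T.coeff.hom) {w : D.PiTemp}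
    (hwΔ : D.aug w = 1) (ζ : cyclotome T.Fn) : w • ζ = ζ := by
  apply hinj
  apply Subtype.ext
  rw [T.coeff.hom_smul, MulAut.conjNormal_apply]
  have hcomm := D.ker_thetaToEll_central (T.coeff.hom ζ : D.GtpTheta) (T.coeff.hom ζ).2 (D.toTheta w)
    ⟨w, MonoidHom.mem_ker.mpr hwΔ, rfl⟩
  rw [mul_inv_eq_iff_eq_mul, hcomm]

/-- **TRANSPORT OF THE FUNCTION-LEVEL PACKAGE ALONG `Δ^tp_Ÿ`-CONJUGATION.** Let `w ∈ Π^tp_Ÿ` with `aug w = 1`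
(`w ∈ Δ^tp_Ÿ`) and let `ι'` agree pointwise with `Ad(w) ∘ ι`. If `ι` carries a function-level [EtTh] Prop 1.4 (ii)
package `{ιFn, hιFn, hΛ, hιθ}` then so does `ι'`, with `ιFn' := w • ιFn(·)`: `w` fixes `Θ̈` and the constants
(`theta_mem`, `const_mem`) and acts trivially on `Λ(Fn)` (`smul_cyclotome_eq_self_of_aug_eq_one`). The inversion of
print is a `Δ^tp_Ÿ`-OUTER automorphism ([IUTchII] Rmk 1.4.1 (ii)), so the package is a class invariant.
[cite: MochizukiEtTh2009, Prop 1.4 (ii) p.22] -/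
theorem exists_package_conj_of_exists_package (hinj : Function.Injective T.coeff.hom) {w : D.PiTemp}
    (hw : w ∈ D.GtpYdd) (hwΔ : D.aug w = 1) (ι ι' : D.PiTemp ≃ₜ* D.PiTemp) (hι' : ∀ g, ι' g = w * ι g * w⁻¹)
    (h : ∃ ιFn : T.Fn →* T.Fn, (∀ (g : D.PiTemp) (f : T.Fn), ιFn (g • f) = ι g • ιFn f) ∧
      (∀ ζ : cyclotome T.Fn, cyclotome.map ιFn ζ = ζ) ∧ ιFn T.theta = T.const (-1) * T.theta) :
    ∃ ιFn : T.Fn →* T.Fn, (∀ (g : D.PiTemp) (f : T.Fn), ιFn (g • f) = ι' g • ιFn f) ∧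
      (∀ ζ : cyclotome T.Fn, cyclotome.map ιFn ζ = ζ) ∧ ιFn T.theta = T.const (-1) * T.theta := by
  obtain ⟨ιFn, hιFn, hΛ, hιθ⟩ := h
  refine ⟨(MulDistribMulAction.toMonoidHom T.Fn w).comp ιFn, fun g f => ?_, fun ζ => ?_, ?_⟩
  · rw [MonoidHom.comp_apply, MulDistribMulAction.toMonoidHom_apply, MonoidHom.comp_apply,
      MulDistribMulAction.toMonoidHom_apply, hιFn, hι', smul_smul, smul_smul, inv_mul_cancel_right]
  · have hζ := T.smul_cyclotome_eq_self_of_aug_eq_one hinj hwΔ ζ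
    apply Subtype.ext
    funext n
    have h1 := congrArg (fun ξ : cyclotome T.Fn => (ξ : ℕ+ → T.Fn) n) (hΛ ζ)
    have h2 := congrArg (fun ξ : cyclotome T.Fn => (ξ : ℕ+ → T.Fn) n) hζ
    simp only [cyclotome.map_apply, cyclotome.smul_apply] at h1 h2
    rw [cyclotome.map_apply, MonoidHom.comp_apply, MulDistribMulAction.toMonoidHom_apply, h1, h2]
  · rw [MonoidHom.comp_apply, MulDistribMulAction.toMonoidHom_apply, hιθ, smul_mul']
    have h1 : w • T.const (-1) = T.const (-1) := T.const_mem (-1) ⟨w, hw⟩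
    have h2 : w • T.theta = T.theta := T.theta_mem ⟨w, hw⟩
    rw [h1, h2]

end ThetaKummerInput

end ThetaSetting

/-! ### §2. At the χ-twisted root model: the half-twisted sections fixed by `Ad(b^z) ∘ ι` -/

namespace SettingModel

open Literature.AnabelianGeometry.AbsoluteAnabelian

variable (p : ℕ) [Fact p.Prime]

/-- On `G_{K_N}` the cyclotomic character is `≡ 1 (mod N)`: `χ(σ)` acts trivially on `Ẑ/NẐ`.
[cite: MochizukiEtTh2009, §1 p.13] -/
theorem level_chi_apply_of_mem_fixingSubgroup_fieldKN (N : ℕ+) {σ : GQp p}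
    (hσ : σ ∈ (fieldKN (⊥ : IntermediateField ℚ_[p] (PadicAlgCl p)) (qModel p) N).fixingSubgroup) (t : ZH) :
    ZHatLevel.level N (chi p σ t) = ZHatLevel.level N t := by
  apply Multiplicative.toAdd.injective
  rw [ZHatLevel.toAdd_level_aut, levelChar_chi_eq_one_of_mem_fixingSubgroup_fieldKN p ⊥ (qModel p) N hσ, one_mul]

/-- In particular (`K_2 = ℚ_p`): `χ(σ) ≡ 1 (mod 2)` for every `σ`, so the `χ`-coboundary `z/χ(σ)z` of any `z ∈ Ẑ` is
EVEN. [cite: MochizukiEtTh2009, §1 p.17] -/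
theorem div_chi_mem_range_sqHom (z : ZH) (σ : GQp p) : z / chi p σ z ∈ sqHom.range := by
  have hσ : σ ∈ (fieldKN (⊥ : IntermediateField ℚ_[p] (PadicAlgCl p)) (qModel p) 2).fixingSubgroup := by
    rw [fieldKN_bot_qModel_two, IntermediateField.fixingSubgroup_bot]
    exact Subgroup.mem_top σ
  rw [mem_range_sqHom_iff, modN_eq_level, map_div, level_chi_apply_of_mem_fixingSubgroup_fieldKN p 2 hσ, div_self']

/-- **Half the coboundary is a `χ`-cocycle**: `f(σ) := ½·(z − χ(σ)z)` (multiplicatively `half (z/χ(σ)z)`) satisfies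
`f(στ) = f(σ)·χ(σ)(f(τ))` (`half` is a homomorphism commuting with `Aut Ẑ`). [cite: NeukirchANT1999, Ch. IV §3] -/
theorem half_div_chi_cocycle (z : ZH) (σ τ : GQp p) :
    half ⟨z / chi p (σ * τ) z, div_chi_mem_range_sqHom p z (σ * τ)⟩ =
      half ⟨z / chi p σ z, div_chi_mem_range_sqHom p z σ⟩ *
        chi p σ (half ⟨z / chi p τ z, div_chi_mem_range_sqHom p z τ⟩) := by
  rw [← half_mulAut, ← map_mul]
  exact congrArg half (Subtype.ext (chiCocycle_coboundary p z σ τ))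

/-- On `G_{K_4}` the half-coboundary is EVEN: `χ(σ) ≡ 1 (mod 4)` ⇒ `z/χ(σ)z = s⁴` ⇒ `half = s²`.
[cite: MochizukiEtTh2009, §1 p.13] -/
theorem level_two_half_div_chi_eq_one (z : ZH) {σ : GQp p}
    (hσ : σ ∈ (fieldKN (⊥ : IntermediateField ℚ_[p] (PadicAlgCl p)) (qModel p) 4).fixingSubgroup) :
    ZHatLevel.level 2 (half ⟨z / chi p σ z, div_chi_mem_range_sqHom p z σ⟩) = 1 := by
  have h4 : ZHatLevel.level 4 (z / chi p σ z) = 1 := by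
    rw [map_div, level_chi_apply_of_mem_fixingSubgroup_fieldKN p 4 hσ, div_self']
  obtain ⟨s, hs⟩ := (ZHatLevel.level_eq_one_iff_exists_pow 4 _).mp h4
  have hhalf : half ⟨z / chi p σ z, div_chi_mem_range_sqHom p z σ⟩ = s ^ 2 := by
    apply sqHom_injective
    rw [sqHom_apply, sqHom_apply, half_sq, ← pow_mul]
    exact hs.symm
  rw [hhalf]
  exact ZHatLevel.level_pow_self 2 s

/-- **NO-GO FOR EVERY `b`-AXIS LIFT `Ad(inl b^z) ∘ ι` AT `modelχ`** (all `z ∈ Ẑ`, all `p`): for every theta-Kummer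
input `T` over the χ-twisted root model compatible with the genuine Kummer data `kummerDataχ` and every `ι'` agreeing
pointwise with `Ad(inl b^z) ∘ ι` (`ι` = abc-iut-L2-d1's inversion of record), there is NO pull-back `ιFn` with
`hιFn ∧ hΛ ∧ hιθ`. The `ι'`-fixed subgroup used: the sections `⟨b^{f σ}, σ⟩`, `(f σ)² = z/χ(σ)z`, over `G_{K_4}` —
inside `Π^tp_Ÿ`, Galois image `G_{K_4}`, `K_4 = ℚ_p(ζ₄, √q_X)` finite. (`z = 0`: F-w5d125g7-1.)
[cite: MochizukiEtTh2009, Prop 1.4 (ii) p.22] -/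
theorem not_exists_package_modelχ_bAxisLift_of_constCompat (z : ZH) (T : (ThetaSetting.modelχ p).ThetaKummerInput)
    (hcc : T.ConstCompat (kummerDataχ p)) (ι' : PiTpχ p ≃ₜ* PiTpχ p)
    (hι' : ∀ x, ι' x = (SemidirectProduct.inl (bPowGfp z) : PiTpχ p) * invχ p x *
      (SemidirectProduct.inl (bPowGfp z))⁻¹) :
    ¬ ∃ ιFn : T.Fn →* T.Fn,
      (letI := T.instAction; ∀ (g : (ThetaSetting.modelχ p).PiTemp) (f : T.Fn),
        ιFn (g • f) = (ι' : (ThetaSetting.modelχ p).PiTemp ≃ₜ* (ThetaSetting.modelχ p).PiTemp) g • ιFn f) ∧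
      (∀ ζ : cyclotome T.Fn, cyclotome.map ιFn ζ = ζ) ∧ ιFn T.theta = T.const (-1) * T.theta := by
  set f : GQp p → ZH := fun σ => half ⟨z / chi p σ z, div_chi_mem_range_sqHom p z σ⟩
  have hf : ∀ σ τ : GQp p, f (σ * τ) = f σ * chi p σ (f τ) := half_div_chi_cocycle p z
  haveI : FiniteDimensional ℚ_[p] (fieldKN (⊥ : IntermediateField ℚ_[p] (PadicAlgCl p)) (qModel p) 4) :=
    finiteDimensional_fieldKN ⊥ (qModel p) 4
  refine (kummerCoreχ p).not_exists_package_of_constCompat_of_fixed T hcc ι'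
    (H₀ := ((fieldKN (⊥ : IntermediateField ℚ_[p] (PadicAlgCl p)) (qModel p) 4).fixingSubgroup).map
      (sectionχ p f hf)) ?_ ?_ (fieldKN ⊥ (qModel p) 4) ?_
  · -- the half-twisted sections over `G_{K_4}` lie in `Π^tp_Ÿ = Π^tp_{Y_2}`
    rintro _ ⟨σ, hσ, rfl⟩
    rw [GtpYdd_modelχ]
    refine (sectionχ_mem_YNχ_iff p f hf 2 σ).mpr ⟨level_two_half_div_chi_eq_one p z hσ, ?_⟩
    rw [fieldKN_bot_qModel_two, IntermediateField.fixingSubgroup_bot]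
    exact Subgroup.mem_top σ
  · -- they are FIXED by `Ad(b^z) ∘ ι`: `ι` inverts the twist, `Ad(b^z)` multiplies it by `z/χ(σ)z = (f σ)²`
    rintro _ ⟨σ, hσ, rfl⟩
    rw [hι', twistedInversionTop_apply, twistedInversion_sectionχ, conj_inl_bPowGfp_sectionχ]
    refine sectionχ_congr p _ hf ?_
    have hsq : (f σ) ^ 2 = z / chi p σ z := half_sq ⟨z / chi p σ z, div_chi_mem_range_sqHom p z σ⟩
    rw [← hsq, pow_two, inv_mul_cancel_left]
  · -- Galois image `G_{K_4}`
    ext σ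
    constructor
    · rintro ⟨_, ⟨_, ⟨σ', hσ', rfl⟩, rfl⟩, rfl⟩
      rw [(kummerCoreχ p).augTheta_toTheta]
      exact hσ'
    · intro hσ
      refine ⟨(ThetaSetting.modelχ p).toTheta (sectionχ p f hf σ), ⟨sectionχ p f hf σ, ⟨σ, hσ, rfl⟩, rfl⟩, ?_⟩
      rw [(kummerCoreχ p).augTheta_toTheta]
      rfl

/-! ### §3. Every vertex-`0` inner lift `Ad(inl γ) ∘ ι`, `inl γ ∈ Π^tp_Y` -/

/-- `ŷ(1) = 0`. [cite: MochizukiEtTh2009, Prop 1.5 p.23] -/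
theorem yCoordχ_one : yCoordχ p 1 = 1 := by
  change eHatB (gfpFst (1 : PiTpχ p).left) = 1
  rw [SemidirectProduct.one_left, map_one, map_one]

/-- On `Δ^tp_X = inl(Γ)` the `y`-coordinate is a homomorphism: `ŷ((inl γ)⁻¹) = ŷ(inl γ)⁻¹`.
[cite: MochizukiEtTh2009, Prop 1.5 p.23] -/
theorem yCoordχ_inl_inv (γ : Gfp) :
    yCoordχ p (SemidirectProduct.inl γ)⁻¹ = (yCoordχ p (SemidirectProduct.inl γ))⁻¹ := by
  have h := yCoordχ_mul p (SemidirectProduct.inl γ) (SemidirectProduct.inl γ)⁻¹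
  rw [mul_inv_cancel, yCoordχ_one, SemidirectProduct.right_inl, map_one, MulAut.one_apply] at h
  exact eq_inv_of_mul_eq_one_right h.symm

/-- **NO VERTEX-`0` INNER LIFT OF THE INVERSION CARRIES THE FUNCTION-LEVEL PACKAGE AT `modelχ`.** For every
`γ ∈ Γ` of degree `0` (`inl γ ∈ Π^tp_Y`), every `ι'` agreeing pointwise with `Ad(inl γ) ∘ ι` (`ι` the inversion of
record), and every theta-Kummer input `T` over `modelχ p` with injective `Λ(Fn) → Δ_Θ` and `ConstCompat kummerDataχ`
(genuine constants), there is NO `ιFn` with `hιFn ∧ hΛ ∧ hιθ`. Proof: `w := inl(b^{ŷ(γ)}·γ⁻¹) ∈ Δ^tp_Ÿ` conjugates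
`Ad(inl γ) ∘ ι` to `Ad(inl b^{ŷ(γ)}) ∘ ι`; transport (§1) and the `b`-axis no-go (§2). Since print's `ι_Ÿ` is a
`Δ^tp_Ÿ`-outer automorphism composed with `Gal(Ÿ/Y)` ([IUTchII] Rmk 1.4.1 (ii)), this exhausts the lifts of the
inversion of record that fix the vertex `0`: at `modelχ` the function-level hypotheses of
`ThetaKummerInversionTransport` / abc-iut-w4-d004's L6 twins are not jointly instantiable for ANY of them.
[cite: MochizukiEtTh2009, Prop 1.4 (ii) p.22] -/
theorem not_exists_package_modelχ_innerLift_of_constCompat (γ : Gfp)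
    (hγ : (SemidirectProduct.inl γ : PiTpχ p) ∈ (ThetaSetting.modelχ p).GtpY)
    (T : (ThetaSetting.modelχ p).ThetaKummerInput) (hinj : letI := T.instAction; Function.Injective T.coeff.hom)
    (hcc : T.ConstCompat (kummerDataχ p)) (ι' : PiTpχ p ≃ₜ* PiTpχ p)
    (hι' : ∀ x, ι' x = (SemidirectProduct.inl γ : PiTpχ p) * invχ p x *
      (SemidirectProduct.inl γ)⁻¹) :
    ¬ ∃ ιFn : T.Fn →* T.Fn,
      (letI := T.instAction; ∀ (g : (ThetaSetting.modelχ p).PiTemp) (f : T.Fn),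
        ιFn (g • f) = (ι' : (ThetaSetting.modelχ p).PiTemp ≃ₜ* (ThetaSetting.modelχ p).PiTemp) g • ιFn f) ∧
      (∀ ζ : cyclotome T.Fn, cyclotome.map ιFn ζ = ζ) ∧ ιFn T.theta = T.const (-1) * T.theta := by
  intro hP
  obtain ⟨ιb, hιb⟩ := exists_continuousMulEquiv_bTwist_invχ p (yCoordχ p (SemidirectProduct.inl γ))
  -- `w := inl(b^{ŷ γ}) · (inl γ)⁻¹ ∈ Δ^tp_Ÿ`
  have hbY : (SemidirectProduct.inl (bPowGfp (yCoordχ p (SemidirectProduct.inl γ))) : PiTpχ p) ∈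
      (ThetaSetting.modelχ p).GtpY :=
    (mem_GtpY_modelχ_iff p _).mpr (by rw [SemidirectProduct.left_inl, gfpSnd_bPowGfp])
  have hwY : (SemidirectProduct.inl (bPowGfp (yCoordχ p (SemidirectProduct.inl γ))) : PiTpχ p) *
      (SemidirectProduct.inl γ)⁻¹ ∈ (ThetaSetting.modelχ p).GtpY :=
    mul_mem hbY (inv_mem hγ)
  have hyw : yCoordχ p ((SemidirectProduct.inl (bPowGfp (yCoordχ p (SemidirectProduct.inl γ))) : PiTpχ p) *
      (SemidirectProduct.inl γ)⁻¹) = 1 := by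
    rw [yCoordχ_mul, SemidirectProduct.right_inl, map_one, MulAut.one_apply, yCoordχ_inl_bPowGfp, yCoordχ_inl_inv,
      mul_inv_cancel]
  have hwYdd : (SemidirectProduct.inl (bPowGfp (yCoordχ p (SemidirectProduct.inl γ))) : PiTpχ p) *
      (SemidirectProduct.inl γ)⁻¹ ∈ (ThetaSetting.modelχ p).GtpYdd := by
    by_contra h
    exact level_two_yCoordχ_ne_one_of_not_mem_GtpYdd p hwY h (by rw [hyw, map_one])
  have hwΔ : (ThetaSetting.modelχ p).aug ((SemidirectProduct.inl (bPowGfp (yCoordχ p (SemidirectProduct.inl γ))) :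
      PiTpχ p) * (SemidirectProduct.inl γ)⁻¹) = 1 := by
    change ((SemidirectProduct.inl (bPowGfp (yCoordχ p (SemidirectProduct.inl γ))) : PiTpχ p) *
      (SemidirectProduct.inl γ)⁻¹).right = 1
    rw [SemidirectProduct.mul_right, SemidirectProduct.inv_right, SemidirectProduct.right_inl,
      SemidirectProduct.right_inl, inv_one, mul_one]
  have hrel : ∀ x, ιb x = (SemidirectProduct.inl (bPowGfp (yCoordχ p (SemidirectProduct.inl γ))) : PiTpχ p) *
      (SemidirectProduct.inl γ)⁻¹ * ι' x *
      ((SemidirectProduct.inl (bPowGfp (yCoordχ p (SemidirectProduct.inl γ))) : PiTpχ p) *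
        (SemidirectProduct.inl γ)⁻¹)⁻¹ := fun x => by
    rw [hιb, hι']
    group
  exact not_exists_package_modelχ_bAxisLift_of_constCompat p _ T hcc ιb hιb
    (T.exists_package_conj_of_exists_package hinj hwYdd hwΔ ι' ιb hrel hP)

/-! ### §4. Stage 2 (`modelχq p 1 2`, `p ≡ 1 (mod 4)`): every vertex-`0` inner lift, from abc-iut-w5-d140's `b`-axis no-go -/

/-- `ŷ(1) = 0` on the stage-2 carrier. [cite: MochizukiEtTh2009, Prop 1.5 p.23] -/
theorem yCoordχq_one (i j : ℤ) : yCoordχq p i j 1 = 1 := by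
  rw [yCoordχq_apply, SemidirectProduct.one_left, map_one, map_one]

/-- `ŷ((inl γ)⁻¹) = ŷ(inl γ)⁻¹` for `γ` of degree `0` (the Tate shear is invisible on `Ker ê`).
[cite: MochizukiEtTh2009, Prop 1.5 p.23] -/
theorem yCoordχq_inl_inv (i j : ℤ) {γ : Gfp} (hγ : gfpSnd γ = 1) :
    yCoordχq p i j (SemidirectProduct.inl γ)⁻¹ = (yCoordχq p i j (SemidirectProduct.inl γ))⁻¹ := by
  have hê : eHat (gfpFst ((SemidirectProduct.inl γ)⁻¹ : PiTpχq p i j).left) = 1 := by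
    rw [← map_inv, SemidirectProduct.left_inl, map_inv, map_inv, eHat_gfpFst_eq_one (MonoidHom.mem_ker.mpr hγ), inv_one]
  have h := yCoordχq_mul_of_eHat_eq_one p i j (SemidirectProduct.inl γ) (SemidirectProduct.inl γ)⁻¹ hê
  rw [mul_inv_cancel, yCoordχq_one, SemidirectProduct.right_inl, map_one, MulAut.one_apply] at h
  exact eq_inv_of_mul_eq_one_right h.symm

/-- **NO VERTEX-`0` INNER LIFT AT STAGE 2 EITHER** (`modelχq p 1 2`, the Prop. 1.5 (iii)-carrying Tate instance,
`p ≡ 1 (mod 4)`): for every `γ ∈ Γ` of degree `0`, every `ι'` agreeing pointwise with `Ad(inl γ) ∘ ι_χq` and every `T`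
with injective `Λ(Fn) → Δ_Θ` and `ConstCompat kummerDataχq`, there is NO `ιFn` with `hιFn ∧ hΛ ∧ hιθ`: transport (§1)
along `w := inl(b^{ŷ(γ)}·γ⁻¹) ∈ Δ^tp_Ÿ` to the `b`-axis lift `Ad(inl b^{ŷ(γ)}) ∘ ι_χq`, killed by abc-iut-w5-d140's
`not_exists_package_modelχq_bTwist_of_constCompat` (p454176). [cite: MochizukiEtTh2009, Prop 1.4 (ii) p.22] -/
theorem not_exists_package_modelχq_innerLift_of_constCompat (hp : p % 4 = 1) (γ : Gfp)
    (hγ : (SemidirectProduct.inl γ : PiTpχq p 1 2) ∈ (ThetaSetting.modelχq p 1 2 even_two).GtpY)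
    (T : (ThetaSetting.modelχq p 1 2 even_two).ThetaKummerInput)
    (hinj : letI := T.instAction; Function.Injective T.coeff.hom)
    (hcc : T.ConstCompat (kummerDataχq p 1 2 even_two)) (ι' : PiTpχq p 1 2 ≃ₜ* PiTpχq p 1 2)
    (hι' : ∀ x, ι' x = (SemidirectProduct.inl γ : PiTpχq p 1 2) * inversionχq p 1 2 x *
      (SemidirectProduct.inl γ)⁻¹) :
    ¬ ∃ ιFn : T.Fn →* T.Fn,
      (letI := T.instAction; ∀ (g : (ThetaSetting.modelχq p 1 2 even_two).PiTemp) (f : T.Fn),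
        ιFn (g • f) = (ι' : (ThetaSetting.modelχq p 1 2 even_two).PiTemp ≃ₜ*
          (ThetaSetting.modelχq p 1 2 even_two).PiTemp) g • ιFn f) ∧
      (∀ ζ : cyclotome T.Fn, cyclotome.map ιFn ζ = ζ) ∧ ιFn T.theta = T.const (-1) * T.theta := by
  intro hP
  have hγ1 : gfpSnd γ = 1 := by
    have h := gfpSnd_left_eq_one_of_mem_gtpY_modelχq p 1 2 even_two hγ
    rwa [SemidirectProduct.left_inl] at h
  obtain ⟨ιb, hιb⟩ := exists_continuousMulEquiv_bTwist_inversionχq p (yCoordχq p 1 2 (SemidirectProduct.inl γ))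
  have hwY : (SemidirectProduct.inl (bPowGfp (yCoordχq p 1 2 (SemidirectProduct.inl γ))) : PiTpχq p 1 2) *
      (SemidirectProduct.inl γ)⁻¹ ∈ (ThetaSetting.modelχq p 1 2 even_two).GtpY :=
    mul_mem (inl_bPowGfp_mem_GtpY_modelχq p 1 2 even_two _) (inv_mem hγ)
  have hyw : yCoordχq p 1 2 ((SemidirectProduct.inl (bPowGfp (yCoordχq p 1 2 (SemidirectProduct.inl γ))) :
      PiTpχq p 1 2) * (SemidirectProduct.inl γ)⁻¹) = 1 := by
    have hê : eHat (gfpFst ((SemidirectProduct.inl γ)⁻¹ : PiTpχq p 1 2).left) = 1 := by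
      rw [← map_inv, SemidirectProduct.left_inl, map_inv, map_inv, eHat_gfpFst_eq_one (MonoidHom.mem_ker.mpr hγ1), inv_one]
    rw [yCoordχq_mul_of_eHat_eq_one p 1 2 _ _ hê, SemidirectProduct.right_inl, map_one, MulAut.one_apply,
      yCoordχq_inl_bPowGfp, yCoordχq_inl_inv p 1 2 hγ1, mul_inv_cancel]
  have hwYdd : (SemidirectProduct.inl (bPowGfp (yCoordχq p 1 2 (SemidirectProduct.inl γ))) : PiTpχq p 1 2) *
      (SemidirectProduct.inl γ)⁻¹ ∈ (ThetaSetting.modelχq p 1 2 even_two).GtpYdd := by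
    refine mem_GtpYdd_modelχq_of_hHat_two_y p 1 2 even_two hwY ((hHat_y_eq_zero_iff 2 _).mpr ?_)
    rw [← yCoordχq_apply, hyw, map_one]
  have hwΔ : (ThetaSetting.modelχq p 1 2 even_two).aug
      ((SemidirectProduct.inl (bPowGfp (yCoordχq p 1 2 (SemidirectProduct.inl γ))) : PiTpχq p 1 2) *
        (SemidirectProduct.inl γ)⁻¹) = 1 := by
    change ((SemidirectProduct.inl (bPowGfp (yCoordχq p 1 2 (SemidirectProduct.inl γ))) : PiTpχq p 1 2) *
      (SemidirectProduct.inl γ)⁻¹).right = 1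
    rw [SemidirectProduct.mul_right, SemidirectProduct.inv_right, SemidirectProduct.right_inl,
      SemidirectProduct.right_inl, inv_one, mul_one]
  have hrel : ∀ x, ιb x = (SemidirectProduct.inl (bPowGfp (yCoordχq p 1 2 (SemidirectProduct.inl γ))) :
        PiTpχq p 1 2) * (SemidirectProduct.inl γ)⁻¹ * ι' x *
      ((SemidirectProduct.inl (bPowGfp (yCoordχq p 1 2 (SemidirectProduct.inl γ))) : PiTpχq p 1 2) *
        (SemidirectProduct.inl γ)⁻¹)⁻¹ := fun x => by
    rw [hιb, hι']
    group
  exact not_exists_package_modelχq_bTwist_of_constCompat p hp T hcc _ ιb hιb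
    (T.exists_package_conj_of_exists_package hinj hwYdd hwΔ ι' ιb hrel hP)

end SettingModel

end Literature.AnabelianGeometry.EtaleTheta

end
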